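import Literature.NumberTheory.Automorphic.Liu2021.LemD1AsPrintedIndexedNonVacuityWeightOne
import Literature.NumberTheory.Automorphic.QuadraticIdelicNormLocalNorms
import Literature.NumberTheory.Automorphic.UnitaryGroupNonsplitPlace
import Literature.NumberTheory.GaloisRepresentations.CMTypeHeckeCharacter
import HarnessLib

/-!
# [Liu2021, Def. 4.1 ∕ 4.3, App. D §D.1 Step 2, Lemma D.1 (3)] — THE PLACE DICHOTOMY for the rows' own Step-2 slot
# `μ_v = localMu L (toHeckeCharacter L ψ) v`: QUADRATIC at every unramified non-split place, NON-QUADRATIC at infinitely many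
# split places

Reproduction ∕ bookkeeping (Literature, THEOREMS ONLY: no definition, no record, no named fact, no `sorry`; nothing is
asserted about Liu's oscillator representations or about the tree's constructed local Weil carriers).

Sequel of `LemD1AsPrintedIndexedNonVacuityWeightOne.lean` (weight one ⇒ `μ_v(x)² ≠ 1` at infinitely many UNSPECIFIED places) and
`LemD1AsPrintedIndexedNonVacuityNonsplitPlace.lean` (at a non-split place every Step-2 `μ` has `μ(ι_v a) = −1` somewhere).  For the CM
rows (`L` CM, `F = L⁺`, `c` = complex conjugation) and their own binders `(ψ, hψ : IsConjugateSymplectic, hw : HasWeight 1)`: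

* §1 **local conjugate self-duality**: `ψ` conjugate symplectic is conjugate self-dual ([Liu2021, Remark 4.2]; tree
  `IsConjugateSymplectic.isConjugateSelfDual`, unconditional), i.e. `ψ(y · ȳ) = 1` on idèles (`isConjugateSelfDual_iff_mul_conj`); at the
  local idèle `⟨x⟩_w` of a place `w` FIXED by `c` (`c • ⟨x⟩_w = ⟨c_w x⟩_w`, tree `algEquiv_smul_localUnits`) this reads
  `ψ_w(x) · ψ_w(c_w x) = 1` (`localComponent_mul_localComponent_conj_eq_one`), so `ψ_w(x)² = ψ_w(x · (c_w x)⁻¹)` (`localComponent_sq_eq`),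
  and `x · (c_w x)⁻¹` is a UNIT (`c_w` preserves the valuation): **if `ψ` is unramified at `w` then `ψ_w² = 1`**
  (`localComponent_sq_eq_one_of_isUnramifiedAt`);
* §2 hence at every NON-SPLIT place `v` of `L⁺` above which `ψ` is unramified — all but finitely many non-split places
  (`finite_nonsplit_not_sq_eq_one` ← tree `HeckeCharacter.finite_ramifiedPlaces_holds`) — the rows' own `μ_v` is QUADRATIC:
  `μ_v(x)² = 1`, `μ_v(x) = ±1`, `μ_v³ = μ_v` (`localMu_apply_sq_eq_one_of_nonsplit_of_isUnramifiedAt`,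
  `localMu_apply_eq_one_or_eq_neg_one_…`, `localMu_pow_three_eq_…`), so the `μ ∕ μ³` separation of `LemD1IndexedNonVacuityAtPlace` §8 and
  of `…WeightOne` is VOID there (`muOf_localMu_pow_three_eq_of_nonsplit_of_isUnramifiedAt`: the two packaged labels coincide);
* §3 therefore (**`exists_split_localMu_sq_ne_one`**) WEIGHT ONE + CONJUGATE SYMPLECTIC ⇒ outside any finite set there is a SPLIT place
  `v` of `L⁺` with `μ_v(x)² ≠ 1` — the non-quadratic places of `…WeightOne` are, up to finitely many, SPLIT —, and
  (**`exists_split_lemD1IndexedFamily_item1_not_lemD1_3_localMu`**) at infinitely many SPLIT places the two-member trivial-carrier collection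
  `(μ_v, e, 1), (μ_v³, e, 1)` with the rows' own `μ_v` passes [Lem. D.1 (1)] and VIOLATES [Lem. D.1 (3)] AS PRINTED (`N ≥ 3`).

Picture for an auditor of the END rows `hD1''` ∕ `hD3` (our bookkeeping, not a claim about Liu's objects): with the rows' OWN `μ`-slot,
the `μ`-conjunct of (3) can separate labels `μ_v ≠ μ_v³` only at split places and at the finitely many ramified non-split places; at the
unramified non-split places it is the `ε`-conjunct (two classes, `…NonsplitPlace` §2b–§2c) that gives (3) its teeth.

What this does NOT give: the behaviour at the finitely many RAMIFIED non-split places; a second Step-2 character different from `μ_v` at a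
prescribed non-split place; anything about the rows' own carriers; Lem. D.1 itself.  HC_CM is NOT proved.

Cell pub-hodgecm2 (COR-CM), audit class of the END rows `hD1''` ∕ `hD3`; seat prover-pub-hodgecm2-b10.

References: [Liu2021] Y. Liu, *Fourier–Jacobi cycles and arithmetic relative trace formula*, Camb. J. Math. 9 (2021) =
arXiv:2102.11518, Def. 4.1 and Remark 4.2 (l. 1900–1905), Def. 4.3, Def. 4.11 (l. 2086), App. D §D.1 Step 2 (l. 5219), Lemma D.1
(1), (3) (l. 5229, 5233); [CasselsFrohlichANT1967] J. Tate, *Global class field theory*, Ch. VII §4 Prop. 4.1; Ch. II §10;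
[TateThesis1967] J. Tate, *Fourier analysis in number fields and Hecke's zeta-functions*, Lemma 3.2.1 (almost all local components
unramified).
-/

noncomputable section

open scoped Matrix MatrixGroups
open NumberField IsDedekindDomain
open Literature.RepresentationTheory
open Literature.NumberTheory.GaloisRepresentations (HeckeCharacter localUnits algEquiv_smul_localUnits)

namespace Literature.NumberTheory.Automorphic.Liu2021.LemD1IndexedNonVacuityPlaceDichotomy

open UnitaryGroup
open Literature.NumberTheory.GelbartRogawski1991.UnitaryDualPair (imagUnit complexConj_imagUnit imagUnit_ne_zero)
open Literature.NumberTheory.GelbartRogawski1991.UnitaryDualPair.LocalSplitting (localMu localMu_apply norm_localMu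
  continuous_localMu localMu_toLocalRing_eq_one_iff)
open Literature.NumberTheory.Automorphic.IdeleClassGroup (toHeckeCharacter isUnitary_toHeckeCharacter IsConjugateSymplectic
  IsConjugateSelfDual HasWeight isConjugateSelfDual_iff_mul_conj)
open Literature.RepresentationTheory.Liu2021 (isOscillatorChar_toHeckeCharacter_iff)

variable (L : Type) [Field L] [NumberField L] [IsCMField L]

local notation3 "cc" => (IsCMField.complexConj L)
local notation3 "L⁺" => (↥(maximalRealSubfield L))

/-! ## §1 Local conjugate self-duality at a place fixed by `c`: `ψ_w(x) · ψ_w(c x) = 1`, hence `ψ_w(x)² = ψ_w(x / c x)` -/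

omit [IsCMField L] in
/-- the Galois action on a local idèle at a place `w` moved to `w'`: `σ • ⟨x⟩_w = ⟨σ x⟩_{w'}` (tree `algEquiv_smul_localUnits`, with the
target place as a variable). [cite: CasselsFrohlichANT1967, Ch. II §10] -/
private theorem smul_localUnits_eq (σ : L ≃ₐ[L⁺] L) {w w' : HeightOneSpectrum (𝓞 L)} (h : σ • w = w')
    (x : (w.adicCompletion L)ˣ) : σ • localUnits w x = localUnits w' (galAdicCompletionUnitsEquiv (L := L) σ h x) := by
  subst h
  exact algEquiv_smul_localUnits L⁺ L σ w x

/-- **local conjugate self-duality at a non-split place**: for a conjugate self-dual `ψ : C_L → S¹` ([Liu2021, Def. 4.1]: `ψ(y ȳ) = 1`)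
and a finite place `w` of `L` fixed by complex conjugation, `ψ_w(x) · ψ_w(c_w x) = 1` for every `x ∈ L_wˣ` (`c_w` the induced automorphism
of `L_w`; `ψ_w` the local component of `toHeckeCharacter ψ`) — the printed identity `ψ(y · ȳ) = 1` at the local idèle `y = ⟨x⟩_w`, whose
conjugate is `⟨c_w x⟩_w`. [cite: Liu2021, Def. 4.1 (l. 1900–1902) and Remark 4.2] -/
theorem localComponent_mul_localComponent_conj_eq_one (ψ : IdeleClassGroup L →ₜ* Circle) (hψ : IsConjugateSelfDual L ψ)
    (w : HeightOneSpectrum (𝓞 L)) (hw : cc • w = w) (x : (w.adicCompletion L)ˣ) :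
    (toHeckeCharacter L ψ).localComponent w x *
        (toHeckeCharacter L ψ).localComponent w (galAdicCompletionUnitsEquiv (L := L) cc hw x) = 1 := by
  have h := (isConjugateSelfDual_iff_mul_conj ψ).1 hψ (localUnits w x)
  rw [smul_localUnits_eq L cc hw x] at h
  apply Units.ext
  have h' : (((toHeckeCharacter L ψ) (localUnits w x * localUnits w (galAdicCompletionUnitsEquiv (L := L) cc hw x)) : ℂˣ) : ℂ) = 1 := by
    rw [IdeleClassGroup.coe_toHeckeCharacter_apply, h, Circle.coe_one]
  rw [HeckeCharacter.localComponent_apply, HeckeCharacter.localComponent_apply, ← map_mul, Units.val_one]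
  exact h'

/-- **… hence `ψ_w(x)² = ψ_w(x · (c_w x)⁻¹)`** at a place fixed by `c`. [cite: Liu2021, Def. 4.1 (l. 1900–1902)] -/
theorem localComponent_sq_eq (ψ : IdeleClassGroup L →ₜ* Circle) (hψ : IsConjugateSelfDual L ψ)
    (w : HeightOneSpectrum (𝓞 L)) (hw : cc • w = w) (x : (w.adicCompletion L)ˣ) :
    (toHeckeCharacter L ψ).localComponent w x ^ 2 =
      (toHeckeCharacter L ψ).localComponent w (x * (galAdicCompletionUnitsEquiv (L := L) cc hw x)⁻¹) := by
  have h := localComponent_mul_localComponent_conj_eq_one L ψ hψ w hw x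
  rw [map_mul, map_inv, ← eq_inv_of_mul_eq_one_left h, sq]

/-- **at a non-split place where `ψ` is UNRAMIFIED, the local component is QUADRATIC: `ψ_w(x)² = 1` for all `x`** — `x · (c_w x)⁻¹`
is a unit (`c_w` preserves the valuation, tree `valued_galAdicCompletionUnitsEquiv`) and an unramified `ψ_w` kills units
(`HeckeCharacter.isUnramifiedAt_iff_forall_valued_eq_one`). [cite: Liu2021, Def. 4.1 (l. 1900–1902)] [cite: CasselsFrohlichANT1967, Ch. VII §4] -/
theorem localComponent_sq_eq_one_of_isUnramifiedAt (ψ : IdeleClassGroup L →ₜ* Circle) (hψ : IsConjugateSelfDual L ψ)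
    (w : HeightOneSpectrum (𝓞 L)) (hw : cc • w = w) (hunr : (toHeckeCharacter L ψ).IsUnramifiedAt w)
    (x : (w.adicCompletion L)ˣ) : (toHeckeCharacter L ψ).localComponent w x ^ 2 = 1 := by
  rw [localComponent_sq_eq L ψ hψ w hw x, HeckeCharacter.localComponent_apply]
  refine HeckeCharacter.isUnramifiedAt_iff_forall_valued_eq_one.1 hunr _ ?_
  rw [Units.val_mul, Units.val_inv_eq_inv_val, map_mul, map_inv₀, valued_galAdicCompletionUnitsEquiv,
    mul_inv_cancel₀ ((Valuation.ne_zero_iff _).2 x.ne_zero)]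

/-! ## §2 The rows' own `μ_v` is QUADRATIC at every non-split place of `L⁺` above which `ψ` is unramified -/

variable (v : HeightOneSpectrum (𝓞 (maximalRealSubfield L)))

/-- **`μ_v(x)² = 1` at a non-split `v` with `ψ` unramified above it** (`μ_v = localMu L (toHeckeCharacter L ψ) v` the rows' Step-2 slot; at a
non-split place `μ_v(x) = ψ_w(x_w)` for the unique `w ∣ v`, tree `PlacesOver.prod_eq_of_smul_eq`).  So at such places `μ_v³ = μ_v`: the
separation `LemD1OfPlace.muOf μ_v ≠ LemD1OfPlace.muOf μ_v³` of `LemD1IndexedNonVacuityAtPlace` §8 ∕ `…WeightOne` is VOID there.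
[cite: Liu2021, App. D §D.1 Step 2 (l. 5219); Def. 4.1] -/
theorem localMu_apply_sq_eq_one_of_nonsplit_of_isUnramifiedAt (ψ : IdeleClassGroup L →ₜ* Circle) (hψ : IsConjugateSelfDual L ψ)
    (w : PlacesOver L v) (hw : cc • w.1 = w.1) (hunr : (toHeckeCharacter L ψ).IsUnramifiedAt w.1) (x : (LocalRing L v)ˣ) :
    localMu L (toHeckeCharacter L ψ) v x ^ 2 = 1 := by
  rw [localMu_apply, PlacesOver.prod_eq_of_smul_eq cc (IsCMField.complexConj_ne_one L) w hw, ← HeckeCharacter.localComponent_apply]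
  exact localComponent_sq_eq_one_of_isUnramifiedAt L ψ hψ w.1 hw hunr _

/-- **… i.e. `μ_v` takes only the values `±1` there** (and the value `−1` IS taken at a non-split place, by
`LemD1IndexedNonVacuityNonsplitPlace.exists_localMu_toHeckeCharacter_apply_eq_neg_one_of_nonsplit`: at an unramified non-split place the
rows' `μ_v` is a character of order EXACTLY `2`). [cite: Liu2021, App. D §D.1 Step 2 (l. 5219); Def. 4.1] -/
theorem localMu_apply_eq_one_or_eq_neg_one_of_nonsplit_of_isUnramifiedAt (ψ : IdeleClassGroup L →ₜ* Circle)
    (hψ : IsConjugateSelfDual L ψ) (w : PlacesOver L v) (hw : cc • w.1 = w.1) (hunr : (toHeckeCharacter L ψ).IsUnramifiedAt w.1)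
    (x : (LocalRing L v)ˣ) :
    localMu L (toHeckeCharacter L ψ) v x = 1 ∨ localMu L (toHeckeCharacter L ψ) v x = -1 := by
  have h := localMu_apply_sq_eq_one_of_nonsplit_of_isUnramifiedAt L v ψ hψ w hw hunr x
  have h2 : (((localMu L (toHeckeCharacter L ψ) v x : ℂˣ) : ℂ)) ^ 2 = 1 := by
    rw [← Units.val_pow_eq_pow_val, h, Units.val_one]
  rcases sq_eq_one_iff.1 h2 with h1 | h1
  · exact Or.inl (Units.ext h1)
  · exact Or.inr (Units.ext (by rw [h1, Units.val_neg, Units.val_one]))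

/-- **… so `μ_v³ = μ_v` there.** [cite: Liu2021, App. D §D.1 Step 2 (l. 5219)] -/
theorem localMu_pow_three_eq_of_nonsplit_of_isUnramifiedAt (ψ : IdeleClassGroup L →ₜ* Circle) (hψ : IsConjugateSelfDual L ψ)
    (w : PlacesOver L v) (hw : cc • w.1 = w.1) (hunr : (toHeckeCharacter L ψ).IsUnramifiedAt w.1) :
    localMu L (toHeckeCharacter L ψ) v ^ 3 = localMu L (toHeckeCharacter L ψ) v := by
  ext x
  rw [MonoidHom.pow_apply, pow_succ, localMu_apply_sq_eq_one_of_nonsplit_of_isUnramifiedAt L v ψ hψ w hw hunr x, one_mul]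

/-- **the non-split places of `L⁺` where the rows' `μ_v` is NOT quadratic lie below the (finitely many) ramified places of `ψ`** —
so they are FINITE in number (tree `HeckeCharacter.finite_ramifiedPlaces_holds`). [cite: Liu2021, App. D §D.1 Step 2 (l. 5219); Def. 4.1]
[cite: TateThesis1967, Lemma 3.2.1] -/
theorem finite_nonsplit_not_sq_eq_one (ψ : IdeleClassGroup L →ₜ* Circle) (hψ : IsConjugateSelfDual L ψ) :
    {v : HeightOneSpectrum (𝓞 L⁺) | (∃ w : PlacesOver L v, cc • w.1 = w.1) ∧
      ∃ x : (LocalRing L v)ˣ, localMu L (toHeckeCharacter L ψ) v x ^ 2 ≠ 1}.Finite := by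
  have hfin := HeckeCharacter.finite_ramifiedPlaces_holds (toHeckeCharacter L ψ)
  refine (hfin.image fun w : HeightOneSpectrum (𝓞 L) => w.under (𝓞 L⁺)).subset ?_
  rintro v ⟨⟨w, hw⟩, x, hx⟩
  refine ⟨w.1, ?_, w.2⟩
  intro hunr
  exact hx (localMu_apply_sq_eq_one_of_nonsplit_of_isUnramifiedAt L v ψ hψ w hw hunr x)

/-! ## §3 Weight one ⇒ the rows' own `μ_v` is non-quadratic at infinitely many SPLIT places -/

/-- **WEIGHT ONE + CONJUGATE SYMPLECTIC ⇒ `μ_v(x)² ≠ 1` at infinitely many SPLIT places of `L⁺`**: outside any finite set `T` there is a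
place `v ∉ T` which SPLITS in `L` (a `w ∣ v` with `c • w ≠ w`) and `x ∈ E_vˣ` with `μ_v(x)² ≠ 1`, `μ_v = localMu L (toHeckeCharacter L ψ) v`.
Proof: `LemD1IndexedNonVacuityWeightOne.exists_localMu_pow_ne_one_of_hasWeight_one` outside `T ∪ {v : v below a ramified place of ψ}`;
a non-split such `v` is excluded by §2.  (The rows' `(μ, hμ : IsConjugateSymplectic, hw : HasWeight 1)` binders are both used.)
[cite: Liu2021, Def. 4.1, Def. 4.3; App. D §D.1 Step 2 (l. 5219)] [cite: CasselsFrohlichANT1967, Ch. VII §4 Prop. 4.1] -/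
theorem exists_split_localMu_sq_ne_one (ψ : IdeleClassGroup L →ₜ* Circle) (hψ : IsConjugateSymplectic L ψ) (hw : HasWeight L ψ 1)
    (T : Finset (HeightOneSpectrum (𝓞 L⁺))) :
    ∃ v : HeightOneSpectrum (𝓞 L⁺), v ∉ T ∧ (∃ w : PlacesOver L v, cc • w.1 ≠ w.1) ∧
      ∃ x : (LocalRing L v)ˣ, localMu L (toHeckeCharacter L ψ) v x ^ 2 ≠ 1 := by
  classical
  have hsd : IsConjugateSelfDual L ψ := hψ.isConjugateSelfDual
  obtain ⟨v, hvT, x, hx⟩ := LemD1IndexedNonVacuityWeightOne.exists_localMu_pow_ne_one_of_hasWeight_one L ψ hw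
    (T ∪ (finite_nonsplit_not_sq_eq_one L ψ hsd).toFinset) two_ne_zero
  rw [Finset.mem_union, not_or, Set.Finite.mem_toFinset, Set.mem_setOf_eq] at hvT
  refine ⟨v, hvT.1, ?_, x, hx⟩
  by_contra hns
  simp only [not_exists, not_not] at hns
  obtain ⟨w⟩ := PlacesOver.nonempty L v
  exact hvT.2 ⟨⟨w, hns w⟩, x, hx⟩

variable (N : ℕ) (J : Matrix (Fin N) (Fin N) L) (hN : 2 ≤ N) (hJh : (J.map (IsCMField.complexConj L))ᵀ = J) (hJdet : J.det ≠ 0)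

/-- **At infinitely many SPLIT places the teeth of [Lem. D.1 (3)] AS PRINTED bite on the rows' own `μ`** (rank `N ≥ 3`): outside any finite
`T` there is a SPLIT place `v` of `L⁺` where — for every hermitian non-degenerate `J` and every representative `e` — the two-member collection
`(μ_v, e, 1), (μ_v³, e, 1)` on the trivial line passes (1) member by member and VIOLATES `LemD1_3AsPrintedI`
(`LemD1IndexedNonVacuityAtPlace.exists_lemD1IndexedFamily_item1_not_lemD1_3_of_sq_ne_one` at the split place of `exists_split_localMu_sq_ne_one`);
at that `v` moreover `E_v` is NOT a field and `1 ∈ MuSet` (`LemD1IndexedNonVacuityAtPlace` §1).  By §2 such a violation with the rows' own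
`μ_v` is impossible at the unramified non-split places (there `μ_v³ = μ_v`), where instead the `ε`-slot carries the teeth of (3)
(`LemD1IndexedNonVacuityNonsplitPlace` §2c). [cite: Liu2021, App. D Lemma D.1 (1) and (3) (l. 5229, 5233); Def. 4.1; Def. 4.3] -/
theorem exists_split_lemD1IndexedFamily_item1_not_lemD1_3_localMu (ψ : IdeleClassGroup L →ₜ* Circle)
    (hψ : IsConjugateSymplectic L ψ) (hw : HasWeight L ψ 1) (T : Finset (HeightOneSpectrum (𝓞 L⁺))) :
    ∃ v : HeightOneSpectrum (𝓞 L⁺), v ∉ T ∧ (∃ w : PlacesOver L v, cc • w.1 ≠ w.1) ∧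
      ∀ (N : ℕ) (J : Matrix (Fin N) (Fin N) L) (hN : 2 ≤ N) (hJh : (J.map (IsCMField.complexConj L))ᵀ = J) (hJdet : J.det ≠ 0)
        (_h3 : 3 ≤ N)
        (e : LemD1.EpsRep (LemD1OfPlace.standingData L v cc N J (complexConj_imagUnit L) (imagUnit_ne_zero L) hN hJh hJdet)),
        ∃ Lf : LemD1IndexedFamily (v.adicCompletion L⁺) (LocalRing L v) N (Fin 2),
          Lf.S = LemD1OfPlace.standingData L v cc N J (complexConj_imagUnit L) (imagUnit_ne_zero L) hN hJh hJdet ∧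
          (∀ i, (Lf.eps i).1 = e.1) ∧ (∀ i, (Lf.chi i).1 = 1) ∧
          (Lf.mu 0).1 = localMu L (toHeckeCharacter L ψ) v ∧ (Lf.mu 1).1 = localMu L (toHeckeCharacter L ψ) v ^ 3 ∧
          Lf.Item1AsPrinted ∧ Lf.mu 0 ≠ Lf.mu 1 ∧ ¬ LemD1_3AsPrintedI Lf := by
  obtain ⟨v, hvT, hsplit, x, hx⟩ := exists_split_localMu_sq_ne_one L ψ hψ hw T
  exact ⟨v, hvT, hsplit, fun N J hN hJh hJdet h3 e =>
    LemD1IndexedNonVacuityAtPlace.exists_lemD1IndexedFamily_item1_not_lemD1_3_of_sq_ne_one L v cc N J (complexConj_imagUnit L)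
      (imagUnit_ne_zero L) hN hJh hJdet h3 (localMu L (toHeckeCharacter L ψ) v)
      (fun x => norm_localMu L (toHeckeCharacter L ψ) v (isUnitary_toHeckeCharacter L ψ) x)
      (continuous_localMu L (toHeckeCharacter L ψ) v)
      (fun t => localMu_toLocalRing_eq_one_iff L (toHeckeCharacter L ψ) v
        ((isOscillatorChar_toHeckeCharacter_iff ψ).mpr hψ) t)
      ⟨x, hx⟩ e⟩

/-- **… and at a non-split place above which `ψ` is unramified the same two labels COINCIDE** through the rows' packaging:
`LemD1OfPlace.muOf μ_v³ = LemD1OfPlace.muOf μ_v` (whatever the accompanying proofs) — the place-by-place complement of the previous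
theorem. [cite: Liu2021, App. D §D.1 Step 2 (l. 5219); Def. 4.1] -/
theorem muOf_localMu_pow_three_eq_of_nonsplit_of_isUnramifiedAt (ψ : IdeleClassGroup L →ₜ* Circle) (hψ : IsConjugateSelfDual L ψ)
    (w : PlacesOver L v) (hw : cc • w.1 = w.1) (hunr : (toHeckeCharacter L ψ).IsUnramifiedAt w.1)
    (hμn : ∀ x, ‖((localMu L (toHeckeCharacter L ψ) v x : ℂˣ) : ℂ)‖ = 1)
    (hμc : Continuous fun x => ((localMu L (toHeckeCharacter L ψ) v x : ℂˣ) : ℂ))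
    (hμF : ∀ a : (v.adicCompletion L⁺)ˣ,
      localMu L (toHeckeCharacter L ψ) v (Units.map (algebraMap (v.adicCompletion L⁺) (LocalRing L v)).toMonoidHom a) = 1 ↔
        ∃ x : (LocalRing L v)ˣ, (x : LocalRing L v) * conjLocal L cc v x = algebraMap (v.adicCompletion L⁺) (LocalRing L v) a)
    (h3n : ∀ x, ‖(((localMu L (toHeckeCharacter L ψ) v ^ 3) x : ℂˣ) : ℂ)‖ = 1)
    (h3c : Continuous fun x => (((localMu L (toHeckeCharacter L ψ) v ^ 3) x : ℂˣ) : ℂ))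
    (h3F : ∀ a : (v.adicCompletion L⁺)ˣ,
      (localMu L (toHeckeCharacter L ψ) v ^ 3) (Units.map (algebraMap (v.adicCompletion L⁺) (LocalRing L v)).toMonoidHom a) = 1 ↔
        ∃ x : (LocalRing L v)ˣ, (x : LocalRing L v) * conjLocal L cc v x = algebraMap (v.adicCompletion L⁺) (LocalRing L v) a) :
    LemD1OfPlace.muOf L v cc N J (complexConj_imagUnit L) (imagUnit_ne_zero L) hN hJh hJdet
        (localMu L (toHeckeCharacter L ψ) v ^ 3) h3n h3c h3F =
      LemD1OfPlace.muOf L v cc N J (complexConj_imagUnit L) (imagUnit_ne_zero L) hN hJh hJdet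
        (localMu L (toHeckeCharacter L ψ) v) hμn hμc hμF :=
  Subtype.ext (localMu_pow_three_eq_of_nonsplit_of_isUnramifiedAt L v ψ hψ w hw hunr)

end Literature.NumberTheory.Automorphic.Liu2021.LemD1IndexedNonVacuityPlaceDichotomy

end
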